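import Summits.CriticalPhenomena.SAWScalingLimit.Theorems.SAWTotalPositivityCriticalBubbleBoundKestenCutBubbleBound

/-!
# Line `kesten-product-renewal-dictionary` (crux stmt-CriticalPhenomena-7117): the two-bridge cut, V —
the PARAMETRIC REDUCTION of the bubble to three exponent bounds

Proof file (lead seat c1). With stub A discharged (`bubble_le_twoBridge`, part IV), the line's composition is
a theorem with the three remaining stubs as hypotheses, stated here PARAMETRICALLY in the exponents so that
it serves whichever values get proved:

* disjointness gain `a`:   `M₂(h) ≤ C₁ (h+1)^{-a} F(h)`            (stub C; predicted worth `3/2`),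
* renewal-density decay `b`: `u_h ≤ C₂ (h+1)^{-b}`                  (stub B2; `b = 0` is Kesten's bound `u_h ≤ 1`,
                                                                      predicted `1/4`),
* pinned length-weighted growth `c`: `L(v) ≤ C₃ (h+1)^{c}` on column `h` (stub B1; predicted `1/12`),

then `F(h) ≤ 2 u_h sup_{v₀ = h} L(v)` (Fubini, `freePairMass_le`) gives `M₂(h) ≤ 2C₁C₂C₃ (h+1)^{-(a+b-c)}`,
summable as soon as `a + b - c > 1`, whence `G_{x_c}(0,e₀) < ∞` (`bubble_ne_top_of_exponents`) — and the crux
by the landed one-number normal form `Negative.criticalBubbleBound_iff_bubble_e₀_ne_top`. The registered line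
(seat …-7117-1) uses `(a, b, c) = (4/3, 0, 1/4)`; the planner's card had `(5/6+ε, 1/4-ε/4, 1/12+ε/4)`.
Source of the Fubini step: the planner's checked skeleton `Lines/kesten-product-renewal-dictionary.lean`.
-/

noncomputable section

open Literature.Probability.LatticeModels
open Literature.Probability.RandomPlanarGeometry Literature.Probability.RandomPlanarGeometry.SAW
open scoped ENNReal NNReal BigOperators
open Summit.CriticalPhenomena.SAWScalingLimit.Theorems.CriticalBubbleBound.Negative (e₀ bubble)

namespace Summit.CriticalPhenomena.SAWScalingLimit.Theorems.CriticalBubbleBound.Kesten.Cut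

/-! ## Fubini: the free pair mass factorises through one-bridge quantities -/

open Classical in
/-- **`F(h) ≤ 2 · u_h · sup_{v₀ = h} L(v)`**: pin the length-weighted bridge of a free apex-meeting pair at the
site dictated by the other one. [folklore] -/
theorem freePairMass_le (h : ℕ) (B : ℝ≥0∞) (hB : ∀ v : Site 2, v 0 = h → pinnedLengthMass v ≤ B) :
    freePairMass h ≤ 2 * (columnMass h * B) := by
  -- the two summands of the length weight, each pinned at the site forced by the other bridge
  let f₁ : BridgePair → ℝ≥0∞ := fun p =>
    (if p.2.span = h then p.2.mass else 0) *
      (if p.1.tip = p.2.tip + eUp then (p.1.len : ℝ≥0∞) * p.1.mass else 0)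
  let f₂ : BridgePair → ℝ≥0∞ := fun p =>
    (if p.1.span = h then p.1.mass else 0) *
      (if p.2.tip = p.1.tip - eUp then (p.2.len : ℝ≥0∞) * p.2.mass else 0)
  have hterm : ∀ p : BridgePair,
      (if ApexMeet p ∧ AtHeight h p then pairWeight p else 0) ≤ f₁ p + f₂ p := by
    intro p
    by_cases hp : ApexMeet p ∧ AtHeight h p
    · obtain ⟨hA, hH⟩ := hp
      have hA' : p.1.tip = p.2.tip + eUp := hA
      have hH' : p.1.span = h := hH
      have h2span : p.2.span = h := by
        have := congrFun hA' 0
        simp only [Pi.add_apply, eUp_zero, add_zero] at this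
        rw [← hH']
        exact this.symm
      have hB2 : p.2.tip = p.1.tip - eUp := by rw [hA', add_sub_cancel_right]
      rw [if_pos ⟨hA, hH⟩]
      simp only [f₁, f₂, if_pos h2span, if_pos hA', if_pos hH', if_pos hB2, pairWeight]
      apply le_of_eq
      ring
    · rw [if_neg hp]
      exact zero_le
  have hpin₁ : ∀ b : Bridge, b.span = h → pinnedLengthMass (b.tip + eUp) ≤ B := fun b hb =>
    hB _ (by simp [hb])
  have hpin₂ : ∀ a : Bridge, a.span = h → pinnedLengthMass (a.tip - eUp) ≤ B := fun a ha =>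
    hB _ (by simp [ha])
  calc freePairMass h
      ≤ ∑' p : BridgePair, (f₁ p + f₂ p) := ENNReal.tsum_le_tsum hterm
    _ = (∑' p : BridgePair, f₁ p) + ∑' p : BridgePair, f₂ p := ENNReal.tsum_add
    _ ≤ columnMass h * B + columnMass h * B := by
        gcongr
        · -- sum over the second bridge outermost
          rw [ENNReal.tsum_prod', ENNReal.tsum_comm]
          calc ∑' (b : Bridge) (a : Bridge), f₁ (a, b)
              = ∑' b : Bridge, (if b.span = h then b.mass else 0) *
                  ∑' a : Bridge, (if a.tip = b.tip + eUp then (a.len : ℝ≥0∞) * a.mass else 0) := by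
                refine tsum_congr fun b => ?_
                rw [← ENNReal.tsum_mul_left]
            _ ≤ ∑' b : Bridge, (if b.span = h then b.mass else 0) * B := by
                refine ENNReal.tsum_le_tsum fun b => ?_
                by_cases hb : b.span = h
                · rw [if_pos hb]
                  exact mul_le_mul' le_rfl (hpin₁ b hb)
                · rw [if_neg hb, zero_mul, zero_mul]
            _ = columnMass h * B := ENNReal.tsum_mul_right
        · rw [ENNReal.tsum_prod']
          calc ∑' (a : Bridge) (b : Bridge), f₂ (a, b)
              = ∑' a : Bridge, (if a.span = h then a.mass else 0) *
                  ∑' b : Bridge, (if b.tip = a.tip - eUp then (b.len : ℝ≥0∞) * b.mass else 0) := by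
                refine tsum_congr fun a => ?_
                rw [← ENNReal.tsum_mul_left]
            _ ≤ ∑' a : Bridge, (if a.span = h then a.mass else 0) * B := by
                refine ENNReal.tsum_le_tsum fun a => ?_
                by_cases ha : a.span = h
                · rw [if_pos ha]
                  exact mul_le_mul' le_rfl (hpin₂ a ha)
                · rw [if_neg ha, zero_mul, zero_mul]
            _ = columnMass h * B := ENNReal.tsum_mul_right
    _ = 2 * (columnMass h * B) := (two_mul _).symm

/-! ## Exponent bookkeeping and summation -/

/-- `t^{-a} · t^{-b} · t^{c} = t^{-(a+b-c)}` in `ℝ≥0∞` for `t > 0`. [folklore] -/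
theorem rpow_product' (a b c : ℝ) {t : ℝ} (ht : 0 < t) :
    ENNReal.ofReal (t ^ (-a)) * ENNReal.ofReal (t ^ (-b)) * ENNReal.ofReal (t ^ c) =
      ENNReal.ofReal (t ^ (-(a + b - c))) := by
  rw [← ENNReal.ofReal_mul (Real.rpow_nonneg ht.le _), ← ENNReal.ofReal_mul
    (mul_nonneg (Real.rpow_nonneg ht.le _) (Real.rpow_nonneg ht.le _)),
    ← Real.rpow_add ht, ← Real.rpow_add ht]
  congr 2
  ring

/-- A `p`-series bound with `p > 1` on the sliced disjoint pair masses makes their total finite. [folklore] -/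
theorem tsum_disjointPairMass_ne_top_of_le {K : ℝ≥0∞} (hK : K ≠ ⊤) {p : ℝ} (hp : 1 < p)
    (hle : ∀ h : ℕ, disjointPairMass h ≤ K * ENNReal.ofReal (((h : ℝ) + 1) ^ (-p))) :
    ∑' h : ℕ, disjointPairMass h ≠ ⊤ := by
  refine ne_top_of_le_ne_top ?_ (ENNReal.tsum_le_tsum hle)
  rw [ENNReal.tsum_mul_left]
  refine ENNReal.mul_ne_top hK ?_
  have hs : Summable fun n : ℕ => ((n : ℝ) + 1) ^ (-p) := by
    have h1 : Summable fun n : ℕ => ((n : ℝ)) ^ (-p) := Real.summable_nat_rpow.2 (by linarith)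
    simpa using (summable_nat_add_iff 1).2 h1
  rw [← ENNReal.ofReal_tsum_of_nonneg (fun n => Real.rpow_nonneg (by positivity) _) hs]
  exact ENNReal.ofReal_ne_top

/-- **The parametric reduction of the line**: disjointness gain `a`, renewal-density decay `b` and pinned
length-weighted growth `c` with `a + b - c > 1` give `G_{x_c}(0,e₀) < ∞` (stub A being the theorem
`bubble_le_twoBridge`); with `Negative.criticalBubbleBound_iff_bubble_e₀_ne_top` this is the crux.
[folklore] -/
theorem bubble_ne_top_of_exponents {a b c : ℝ} (habc : 1 < a + b - c)
    (hC : ∃ C : ℝ≥0, ∀ h : ℕ,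
      disjointPairMass h ≤ (C : ℝ≥0∞) * ENNReal.ofReal (((h : ℝ) + 1) ^ (-a)) * freePairMass h)
    (hB2 : ∃ C : ℝ≥0, ∀ h : ℕ, columnMass h ≤ (C : ℝ≥0∞) * ENNReal.ofReal (((h : ℝ) + 1) ^ (-b)))
    (hB1 : ∃ C : ℝ≥0, ∀ (h : ℕ) (v : Site 2), v 0 = h →
      pinnedLengthMass v ≤ (C : ℝ≥0∞) * ENNReal.ofReal (((h : ℝ) + 1) ^ c)) :
    bubble e₀ ≠ ⊤ := by
  obtain ⟨C₁, hC₁⟩ := hC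
  obtain ⟨C₂, hC₂⟩ := hB2
  obtain ⟨C₃, hC₃⟩ := hB1
  have hcol : ∀ h : ℕ, disjointPairMass h ≤
      (2 * C₁ * C₂ * C₃ : ℝ≥0∞) * ENNReal.ofReal (((h : ℝ) + 1) ^ (-(a + b - c))) := by
    intro h
    have ht : (0 : ℝ) < (h : ℝ) + 1 := by positivity
    have hF : freePairMass h ≤ 2 * (columnMass h *
        ((C₃ : ℝ≥0∞) * ENNReal.ofReal (((h : ℝ) + 1) ^ c))) :=
      freePairMass_le h _ (fun v hv => hC₃ h v hv)
    calc disjointPairMass h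
        ≤ (C₁ : ℝ≥0∞) * ENNReal.ofReal (((h : ℝ) + 1) ^ (-a)) * freePairMass h := hC₁ h
      _ ≤ (C₁ : ℝ≥0∞) * ENNReal.ofReal (((h : ℝ) + 1) ^ (-a)) *
            (2 * (((C₂ : ℝ≥0∞) * ENNReal.ofReal (((h : ℝ) + 1) ^ (-b))) *
              ((C₃ : ℝ≥0∞) * ENNReal.ofReal (((h : ℝ) + 1) ^ c)))) := by
          gcongr
          exact hF.trans (by gcongr; exact hC₂ h)
      _ = (2 * C₁ * C₂ * C₃ : ℝ≥0∞) *
            (ENNReal.ofReal (((h : ℝ) + 1) ^ (-a)) * ENNReal.ofReal (((h : ℝ) + 1) ^ (-b)) *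
              ENNReal.ofReal (((h : ℝ) + 1) ^ c)) := by ring
      _ = (2 * C₁ * C₂ * C₃ : ℝ≥0∞) * ENNReal.ofReal (((h : ℝ) + 1) ^ (-(a + b - c))) := by
          rw [rpow_product' a b c ht]
  have hK : (2 * C₁ * C₂ * C₃ : ℝ≥0∞) ≠ ⊤ :=
    ENNReal.mul_ne_top (ENNReal.mul_ne_top (ENNReal.mul_ne_top ENNReal.ofNat_ne_top ENNReal.coe_ne_top)
      ENNReal.coe_ne_top) ENNReal.coe_ne_top
  exact bubble_ne_top_of_tsum_disjointPairMass_ne_top (tsum_disjointPairMass_ne_top_of_le hK habc hcol)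

/-- **The registered line's instance** `(a, b, c) = (4/3, 0, 1/4)`: disjointness gain `4/3`, Kesten's bound
`u_h ≤ C`, and pinned growth `1/4` give `G_{x_c}(0,e₀) < ∞`. [folklore] -/
theorem bubble_ne_top_of_gain_kesten_pinned : (∃ C : ℝ≥0, ∀ h : ℕ, disjointPairMass h ≤ (C : ℝ≥0∞) * ENNReal.ofReal (((h : ℝ) + 1) ^ (-(4 / 3 : ℝ))) * freePairMass h) → (∃ C : ℝ≥0, ∀ h : ℕ, columnMass h ≤ (C : ℝ≥0∞)) → (∃ C : ℝ≥0, ∀ (h : ℕ) (v : Site 2), v 0 = h → pinnedLengthMass v ≤ (C : ℝ≥0∞) * ENNReal.ofReal (((h : ℝ) + 1) ^ (1 / 4 : ℝ))) → bubble e₀ ≠ ⊤ := by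
  intro hC hB2 hB1
  refine bubble_ne_top_of_exponents (a := 4 / 3) (b := 0) (c := 1 / 4) (by norm_num) hC ?_ hB1
  obtain ⟨C, hC⟩ := hB2
  exact ⟨C, fun h => by simpa using hC h⟩

end Summit.CriticalPhenomena.SAWScalingLimit.Theorems.CriticalBubbleBound.Kesten.Cut

end
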